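import Summits.BirchSwinnertonDyer.BirchSwinnertonDyer.Theses.SelmerRank
import Summits.BirchSwinnertonDyer.BirchSwinnertonDyer.Theorems.SelmerRankSelmerRankLBStubDeltaOne
import Summits.BirchSwinnertonDyer.BirchSwinnertonDyer.Theorems.SelmerRankSelmerRankLBStubDeltaParity
import Literature.NumberTheory.EllipticCurves.KuriharaNumber
import Literature.NumberTheory.EllipticCurves.KatoKolyvaginPrimes
import Literature.NumberTheory.EllipticCurves.CuspFormLFunction
import Literature.NumberTheory.EllipticCurves.NonEisensteinPrimeOfSurjective
import Literature.NumberTheory.EllipticCurves.AnalyticRankModularityProofs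
import Literature.NumberTheory.EllipticCurves.BSDAnalyticRankProofs
import Literature.NumberTheory.EllipticCurves.LeadingTermPPartProofs

/-!
# Line `kurihara-two` for crux `SelmerRankRankTwo` (stmt-BirchSwinnertonDyer-0129)

Registered by the crux-strategist seat `cstrat-stmt-BirchSwinnertonDyer-0129-s2` (2026-08-17; no lead,
no earlier line, no `Disproof.lean` for this crux). Card: `Lines/kurihara-two.md`; census:
`STRATEGY-CENSUS.md` (same crux directory). Slug `kurihara-two`.

## The crux (route `SelmerRank`, rank 2; carried UNUSED by `closes`, implied by UB ∧ LB)

`∀ W p, 5 ≤ p → good at p → p ∤ a_p → ρ̄_{E,p} onto → (corank_p Sel_{p^∞}(E/ℚ) = 2 ↔ ord_{s=1} L(E,s) = 2)`: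
the VALUE-2 CELL of `p^∞`-Selmer BSD at a big-image good ordinary prime — the only cell of the
table `{corank, r_an} ≤ 3` that is open (Castella–Hsieh 2022 Conj. 1.2 (2)⇔(4) prints it as a
conjecture). Its two directions are the first open instances of the sibling cruxes:
(→) `corank = 2 ⇒ r_an = 2` is `SelmerRankLB` at `(r_an, corank) = (4, 2)` (the rank-2 `p`-converse);
(←) `r_an = 2 ⇒ corank = 2` is `SelmerRankUB` at `(corank, r_an) = (4, 2)` (a Selmer CAP from a
double zero).

## The line: Kim's structure theorem at value 2 — BOTH directions become statements about
## depth-2 Kurihara numbers, one a VANISHING statement, the other a NON-VANISHING statement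

Lever (C.-H. Kim, arXiv:2203.12159 = Amer. J. Math. 2026, Thm. 1.9 (1) + Cor. 1.6; tree facts
`Kim2022_exists_kuriharaNumber_ne_zero_of_selmerCorank` (lower) and
`Kim2022_selmerCorank_le_of_kuriharaNumber_ne_zero` (upper)): at a good ordinary `p ≥ 5` with `ρ̄`
onto, `corank_p = ord(δ̃) = min{ν(n) : δ̃_n ≠ 0}`. Hence, with V0 (`δ_1 = L(E,1)/Ω⁺`, landed
`Theorems.stub_delta_one`), V1 (Mazur–Tate functional equation, landed `Theorems.stub_delta_parity`)
and `p`-parity, the crux is EQUIVALENT to the conjunction of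

* (A→) `stub_delta_two_of_four_le`: `r_an` even `≥ 4` ⇒ every depth-2 Kurihara number
  `δ_{ℓℓ'}^{(k)} = Σ_{a mod ℓℓ'} [a/ℓℓ']⁺ log_{η_ℓ}(a) log_{η_ℓ'}(a)` vanishes mod `p^k`
  — the `ν = 2` slice of the sibling line's open core `KuriharaOrder.stub_delta_evenGap`
  (crux `SelmerRankLB`, `Cruxes/SelmerRankLB/Lines/kurihara_order.lean`), i.e. the rank-2
  `p`-converse with all algebra discharged; OPEN;
* (A←) `stub_exists_delta_of_rank_two`: `r_an = 2` ⇒ SOME Kurihara number of depth `≤ 2` is non-zero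
  mod `p^k` for some `k ≥ 1` — the UB-side of the cell with all algebra discharged: a mod-`p^k`
  NON-VANISHING statement for the second tame Taylor coefficients of the Mazur–Tate elements of an
  analytic-rank-2 curve; OPEN, but with a working evidence channel (both `r_an = 2` and the
  conclusion are certifiable instance-wise; Kim 2022 §8, PDF p. 34: `δ̃^{(1)}_{41·61}(389a1) ≠ 0 ∈ 𝔽_5`
  is an instance in print) — NEW relative to the sibling line, which has no non-vanishing stub;

plus three stubs KNOWN IN PRINT: KL = Kim lower (= the sibling line's stub K verbatim, closed modulo
{modularity, F1, F2} by the landed `Theorems.stub_kim_order_le_corank_of_facts`), KU = Kim upper in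
the crux's clothing (closable modulo {F3 `Kim2022_selmerCorank_le_of_kuriharaNumber_ne_zero`, F2
`realPeriodRat_eq_unit_mul_plusPeriod`} in ≤ 15 lines, pattern of
`Theorems.stub_delta_prime_of_odd_rank_of_facts`), P = `p`-parity (tree fact
`selmerCorank_mod_two_eq`, Dokchitser–Dokchitser 2010 Thm. 1.4). The rank-0 inputs of the cell
(Kato: `L(E,1) ≠ 0 ⇒ corank = 0`; Skinner–Urban/BCS: `L(E,1) = 0 ⇒ corank ≥ 1`) are NOT separate
stubs: they are KU resp. KL at `n = 1` combined with the PROVED glue lemma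
`one_le_analyticRank_of_kuriharaNumber_one_eq_zero` (this file: `p`-integrality of `[0]⁺_f`,
`PadicInt.ext_of_toZModPow`, `L(E,1) = [0]⁺_f·Ω⁺_f`, per-curve Hecke continuation) and V0.

        SelmerRankRankTwo ⇐ KL ∧ KU ∧ P ∧ A→ ∧ A←        (`SelmerRankRankTwo_of`, sorry-free)
        (→) corank = 2: KU at n = 1 ⇒ all δ_1^{(k)} = 0 ⇒ r_an ≥ 1 (glue lemma) ⇒ r_an even ≥ 2 (P);
            if r_an ≥ 4, KL's witness n (ν(n) ≤ 2, δ_n ≠ 0) is killed by V0 / V1 / A→. ∎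
        (←) r_an = 2: A←'s witness and KU give corank ≤ 2; P gives corank even; corank = 0 would
            make KL's witness n = 1 with δ_1 ≠ 0, against V0. ∎

Disproof.lean: none exists for stmt-0129. Typing checklist 4c: no determinantal representation, no
Bochner integral, no complex-action partition function, no hand-picked threshold; discrete
logarithms universally (A→) resp. existentially (A←, KL) quantified with surjectivity, level
`k ≥ 1` explicit, `n ≠ 0` via `NeZero` + `IsKolyvaginProduct`.
-/

noncomputable section

set_option linter.dupNamespace false

open scoped MatrixGroups ModularForm Classical

open CongruenceSubgroup Literature.NumberTheory.EllipticCurves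
  Literature.NumberTheory.EllipticCurves.ModularForms

namespace Summit.BirchSwinnertonDyer.BirchSwinnertonDyer.Cruxes.SelmerRankRankTwo.KuriharaTwo

open Summit.BirchSwinnertonDyer.BirchSwinnertonDyer.Theses

/-! ### Stub KL — Kim's theorem, non-vanishing (lower) direction (known in print, XL) -/

/-- **Stub KL (`stub_kim_lower`) — the first non-vanishing Kurihara number sits at depth `≤ corank`.**
Verbatim the statement of stub K of the sibling line `kurihara_order` (crux `SelmerRankLB`): for
globally minimal elliptic `W/ℚ`, `p ≥ 5` good ordinary with `ρ̄_{E,p}` onto, `N_E > 0`, `W` has a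
newform `f ∈ S₂(Γ₀(N_E))`, and there are `k ≥ 1`, `n ∈ 𝒩_k` with `ν(n) ≤ corank_p Sel_{p^∞}(E/ℚ)`
and surjective discrete logarithms with `kuriharaNumber f (p^k) n ψ ≠ 0`. In print: Kim 2022
Thm. 1.9 (1) + Cor. 1.6 (main conjecture localised at `XΛ`: Kato 2004 Thm. 17.4 +
Burungale–Castella–Skinner 2025 Thm. 1.1.2). CLOSED MODULO FACTS by the landed
`Theorems.stub_kim_order_le_corank_of_facts : exists_isNewformOf →
Kim2022_exists_kuriharaNumber_ne_zero_of_selmerCorank → realPeriodRat_eq_unit_mul_plusPeriod → KL`.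
[cite: Kim2022StructureSelmer, Thm. 1.9 (1), Cor. 1.6] -/
theorem stub_kim_lower :
    ∀ (W : WeierstrassCurve ℚ) [W.IsElliptic] [W.IsGloballyMinimal] (p : ℕ) [Fact p.Prime],
      5 ≤ p → W.HasGoodReductionAtPrime p → ¬ (p : ℤ) ∣ W.frobeniusTrace p →
      W.HasSurjectiveModNGaloisRep p →
      ∃ (_ : NeZero (W.conductorNorm ℤ)) (f : CuspForm (Gamma0 (W.conductorNorm ℤ)) 2),
        IsNewformOf W f ∧
        ∃ (k n : ℕ) (_ : NeZero n), 1 ≤ k ∧ Kato.IsKolyvaginProduct W p k n ∧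
          n.primeFactors.card ≤ W.selmerCorank p ∧
          ∃ ψ : (ℓ : ℕ) → (ZMod ℓ)ˣ →* Multiplicative (ZMod (p ^ k)),
            (∀ ℓ ∈ n.primeFactors, Function.Surjective (ψ ℓ)) ∧
            kuriharaNumber f (p ^ k) n ψ ≠ 0 := by
  -- = `Theorems.stub_kim_order_le_corank_of_facts hmod hF1 hF2` once the three facts have `_holds`
  sorry

/-! ### Stub KU — Kim's theorem, upper direction (known in print, XL) -/

/-- **Stub KU (`stub_kim_upper`) — a non-zero Kurihara number at depth `ν(n)` caps the corank by
`ν(n)`.** For `W`, `p ≥ 5` good ordinary with `ρ̄` onto, the newform `f` of `W` at level `N_E`,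
`k ≥ 1`, `n ∈ 𝒩_k`, surjective logarithms: `kuriharaNumber f (p^k) n ψ ≠ 0 ⇒ corank_p ≤ ν(n)`.
In print: Kim 2022 Thm. 1.9 (1) (`cork = ord(δ̃)`, upper inequality: a theorem as printed, no
Iwasawa input needed for this direction). Tree: the named fact
`Kim2022_selmerCorank_le_of_kuriharaNumber_ne_zero` (F3) carries an explicit period-transfer
hypothesis, supplied at a good `p ≥ 5` with `E[p]` irreducible by the named fact
`realPeriodRat_eq_unit_mul_plusPeriod` (F2); so KU is closable MODULO {F3, F2} exactly as
`Theorems.stub_delta_prime_of_odd_rank_of_facts` (irreducibility from surjectivity by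
`hasIrreducibleModPGaloisRep_of_hasSurjectiveModNGaloisRep`). Size XL unconditionally.
[cite: Kim2022StructureSelmer, Thm. 1.9 (1) (PDF p. 7)] -/
theorem stub_kim_upper :
    ∀ (W : WeierstrassCurve ℚ) [W.IsElliptic] [W.IsGloballyMinimal] (p : ℕ) [Fact p.Prime],
      5 ≤ p → W.HasGoodReductionAtPrime p → ¬ (p : ℤ) ∣ W.frobeniusTrace p →
      W.HasSurjectiveModNGaloisRep p →
      ∀ (_ : NeZero (W.conductorNorm ℤ)) (f : CuspForm (Gamma0 (W.conductorNorm ℤ)) 2),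
        IsNewformOf W f →
        ∀ (k n : ℕ) [NeZero n], 1 ≤ k → Kato.IsKolyvaginProduct W p k n →
          ∀ ψ : (ℓ : ℕ) → (ZMod ℓ)ˣ →* Multiplicative (ZMod (p ^ k)),
            (∀ ℓ ∈ n.primeFactors, Function.Surjective (ψ ℓ)) →
            kuriharaNumber f (p ^ k) n ψ ≠ 0 → W.selmerCorank p ≤ n.primeFactors.card := by
  sorry

/-! ### Stub P — `p`-parity (known in print, XL) -/

/-- **Stub P (`stub_parity`) — `corank_p Sel_{p^∞}(E/ℚ) ≡ ord_{s=1} L(E,s) (mod 2)`** under the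
crux hypotheses (it holds for every `E/ℚ` and every `p`: the `p`-parity theorem, Dokchitser–Dokchitser
2010 Thm. 1.4, combined with `w(E) = (−1)^{r_an}`; tree named fact `selmerCorank_mod_two_eq`, with
many `_of_facts` reductions in `BSDSelmerParity*Proofs`). [cite: DokchitserDokchitserAnnals2010, Thm. 1.4] -/
theorem stub_parity :
    ∀ (W : WeierstrassCurve ℚ) [W.IsElliptic] [W.IsGloballyMinimal] (p : ℕ) [Fact p.Prime],
      5 ≤ p → W.HasGoodReductionAtPrime p → ¬ (p : ℤ) ∣ W.frobeniusTrace p →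
      W.HasSurjectiveModNGaloisRep p → W.selmerCorank p % 2 = W.analyticRank % 2 := by
  sorry

/-! ### Stub A→ — depth-2 Kurihara numbers vanish in even analytic rank `≥ 4` (OPEN; the `ν = 2` slice of the sibling's V2b) -/

/-- **Stub A→ (`stub_delta_two_of_four_le`) — the rank-2 `p`-converse, Selmer-free.** For `W`,
`p ≥ 5` good ordinary with `ρ̄` onto, the newform `f` of `W`, `k ≥ 1`, `n = ℓℓ' ∈ 𝒩_k` with
EXACTLY two prime factors, `ord_{s=1} L(E,s)` even and `≥ 4`, and surjective logarithms:
`kuriharaNumber f (p^k) n ψ = 0`, i.e. `Σ_{a ∈ (ℤ/ℓℓ')ˣ} [a/ℓℓ']⁺ log_{η_ℓ}(a) log_{η_ℓ'}(a) ≡ 0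
(mod p^k)`. Implied by (and the first-instance family of) the sibling line's open core
`KuriharaOrder.stub_delta_evenGap` (`2 ≤ ν(n) < r_an`, `ν ≡ r_an (2)`); equivalent, given KL, KU, P,
V0, V1 and the rank-0 glue, to the direction `corank_p = 2 ⇒ r_an = 2` of the crux. Predicted by
BSD ∘ Kim (Kim Cor. 1.14: `δ̃_n ≠ 0 ⇒ rank E(ℚ) ≤ ν(n)`) and by the analytic-rank form of the
Mazur–Tate weak vanishing conjecture `θ_{ℚ(μ_n)} ∈ I^{r_an}` (Mazur–Tate 1987 Conj. 1). WHY IT MIGHT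
FAIL: it cannot unless BSD-rank does (a witness is a curve with `r_an ≥ 4`, `corank_p = 2`); the
risk is that any proof needs an arithmetic avatar of `L''(E,1) = 0`, unknown over `ℚ`; no instance
is certifiable (`r_an ≥ 4` is never certified: NumericalVanishing barrier).
[cite: Kim2022StructureSelmer, Thm. 1.9, Cor. 1.14, §3.5] [cite: MazurTate1987, Conj. 1] -/
theorem stub_delta_two_of_four_le :
    ∀ (W : WeierstrassCurve ℚ) [W.IsElliptic] [W.IsGloballyMinimal] (p : ℕ) [Fact p.Prime],
      5 ≤ p → W.HasGoodReductionAtPrime p → ¬ (p : ℤ) ∣ W.frobeniusTrace p →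
      W.HasSurjectiveModNGaloisRep p →
      ∀ (_ : NeZero (W.conductorNorm ℤ)) (f : CuspForm (Gamma0 (W.conductorNorm ℤ)) 2),
        IsNewformOf W f →
        ∀ (k n : ℕ) [NeZero n], 1 ≤ k → Kato.IsKolyvaginProduct W p k n → n.primeFactors.card = 2 →
          Even W.analyticRank → 4 ≤ W.analyticRank →
          ∀ ψ : (ℓ : ℕ) → (ZMod ℓ)ˣ →* Multiplicative (ZMod (p ^ k)),
            (∀ ℓ ∈ n.primeFactors, Function.Surjective (ψ ℓ)) →
            kuriharaNumber f (p ^ k) n ψ = 0 := by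
  sorry

/-! ### Stub A← — an analytic-rank-2 curve has a non-vanishing Kurihara number of depth `≤ 2` (OPEN; NEW) -/

/-- **Stub A← (`stub_exists_delta_of_rank_two`) — the Selmer cap from a double zero, Selmer-free.**
For `W`, `p ≥ 5` good ordinary with `ρ̄` onto and `ord_{s=1} L(E,s) = 2`: `N_E > 0`, `W` has a
newform `f ∈ S₂(Γ₀(N_E))`, and there are `k ≥ 1`, `n ∈ 𝒩_k` with `ν(n) ≤ 2` and surjective
logarithms with `kuriharaNumber f (p^k) n ψ ≠ 0` (by V0 and V1 such an `n` necessarily has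
`ν(n) = 2`: some `δ_{ℓℓ'}^{(k)} ≢ 0`). Equivalent, given KL, KU, P, V0, to the direction
`r_an = 2 ⇒ corank_p = 2` of the crux (= `SelmerRankUB` at `r_an = 2`: no `E` with `r_an = 2` has
`rank ≥ 4` or `(ℚ_p/ℤ_p)² ⊂ Ш[p^∞]`). Predicted by BSD-rank ∧ `Ш[p^∞]` finite (then `corank_p = 2`
and Kim's lower direction gives the witness). Unlike A→ it has a working evidence channel: `r_an = 2`
IS certifiable (`w = +1`, `[0]⁺ = 0` exactly, `L''(E,1) ≠ 0` by interval arithmetic) and each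
`δ_n^{(k)}` is a finite modular-symbol computation; Kim 2022 §8 (PDF p. 34), `p = 5`:
"`δ̃^{(1)}_{41·61}(E_{389.a1}) ≠ 0 ∈ 𝔽_5`" is an instance in print (smallest-conductor rank-2 curve),
and every `(E, p)` at which `ord_T L_p(E,T) = 2` has been verified (Stein–Wuthrich 2013) is an
instance via Kato's divisibility + KL. WHY IT MIGHT FAIL: only together with BSD-rank or
`Ш[p^∞]`-cotorsion in analytic rank 2; the risk is again the missing avatar — here of
`L''(E,1) ≠ 0` — but the statement asks for NON-vanishing mod `p^k` of ONE twisted-`L`-value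
combination among infinitely many, the shape in which analytic number theory proves things
(non-vanishing of twists mod `p`: Vatsal, Burungale–Sun; modular-symbol statistics: Mazur–Rubin,
Petridis–Risager). [cite: Kim2022StructureSelmer, Thm. 1.9 (1), Cor. 1.6, §8 (PDF p. 34)]
[cite: CastellaHsieh2022, Conj. 1.2 and Rmk. 1.3] -/
theorem stub_exists_delta_of_rank_two :
    ∀ (W : WeierstrassCurve ℚ) [W.IsElliptic] [W.IsGloballyMinimal] (p : ℕ) [Fact p.Prime],
      5 ≤ p → W.HasGoodReductionAtPrime p → ¬ (p : ℤ) ∣ W.frobeniusTrace p →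
      W.HasSurjectiveModNGaloisRep p → W.analyticRank = 2 →
      ∃ (_ : NeZero (W.conductorNorm ℤ)) (f : CuspForm (Gamma0 (W.conductorNorm ℤ)) 2),
        IsNewformOf W f ∧
        ∃ (k n : ℕ) (_ : NeZero n), 1 ≤ k ∧ Kato.IsKolyvaginProduct W p k n ∧
          n.primeFactors.card ≤ 2 ∧
          ∃ ψ : (ℓ : ℕ) → (ZMod ℓ)ˣ →* Multiplicative (ZMod (p ^ k)),
            (∀ ℓ ∈ n.primeFactors, Function.Surjective (ψ ℓ)) ∧
            kuriharaNumber f (p ^ k) n ψ ≠ 0 := by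
  sorry

/-! ### The stub statements as named propositions -/

namespace Statement

/-- Statement of stub KL. [folklore] -/
abbrev stub_kim_lower : Prop := type_of% @KuriharaTwo.stub_kim_lower
/-- Statement of stub KU. [folklore] -/
abbrev stub_kim_upper : Prop := type_of% @KuriharaTwo.stub_kim_upper
/-- Statement of stub P. [folklore] -/
abbrev stub_parity : Prop := type_of% @KuriharaTwo.stub_parity
/-- Statement of stub A→. [folklore] -/
abbrev stub_delta_two_of_four_le : Prop := type_of% @KuriharaTwo.stub_delta_two_of_four_le
/-- Statement of stub A←. [folklore] -/
abbrev stub_exists_delta_of_rank_two : Prop := type_of% @KuriharaTwo.stub_exists_delta_of_rank_two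

end Statement

/-! ### Proved glue: the rank-0 inputs of the cell in Kurihara clothing -/

/-- **`δ_1^{(k)} = 0` for every `k ≥ 1` forces `r_an ≥ 1`** (converse of the landed V0
`Theorems.stub_delta_one`). For the newform `f` of an elliptic `W/ℚ` (any level `N ≥ 1`) and an
odd prime `p` with `E[p]` irreducible: `[0]⁺_f` is `p`-integral
(`IsNewformOf.not_dvd_den_ratPlusSymbol_div`), so `δ_1^{(k)} = ratModP (p^k) [0]⁺_f` is its image
under `ℤ_p → ℤ/p^k` (`kuriharaNumber_one`, `ratModP_eq_toZModPow`); if all these vanish, `[0]⁺_f = 0`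
in `ℤ_p` (`PadicInt.ext_of_toZModPow`), hence in `ℚ`, hence `L(E,1) = [0]⁺_f · Ω⁺_f = 0`
(`IsNewformOf.entireLFunction_one_eq`), and since `L(E,s)` has Hecke's entire continuation for this
modular `W` (`WeierstrassCurve.hasEntireLFunction_of_cuspCoeff_eq`) its order at `1` is positive
(`analyticRank_ne_zero_of_entireLFunction_one_eq_zero`). This is how Kato's `L(E,1) ≠ 0 ⇒ corank = 0`
(via KU at `n = 1`) and the rank-0 converse `L(E,1) = 0 ⇒ corank ≥ 1` (via KL at `n = 1` + V0) enter
the line without separate stubs. [folklore] -/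
theorem one_le_analyticRank_of_kuriharaNumber_one_eq_zero
    {W : WeierstrassCurve ℚ} [W.IsElliptic] [W.IsGloballyMinimal] {N : ℕ} [NeZero N]
    {f : CuspForm (Gamma0 N) 2} (hf : IsNewformOf W f) {p : ℕ} [Fact p.Prime] (hp2 : p ≠ 2)
    (hirr : W.HasIrreducibleModPGaloisRep p)
    (ψ : (k : ℕ) → (ℓ : ℕ) → (ZMod ℓ)ˣ →* Multiplicative (ZMod (p ^ k)))
    (h : ∀ k : ℕ, 1 ≤ k → kuriharaNumber f (p ^ k) 1 (ψ k) = 0) :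
    1 ≤ W.analyticRank := by
  -- `[0]⁺_f` is `p`-integral
  have hden : ¬ p ∣ (ratPlusSymbol f 0).den := by
    simpa using hf.not_dvd_den_ratPlusSymbol_div hp2 hirr (Nat.coprime_one_left N) 0
  -- all reductions mod `p^k` vanish, so `[0]⁺_f = 0` in `ℤ_p`
  have hx0 : (0 : ℤ_[p]) = ⟨((ratPlusSymbol f 0 : ℚ) : ℚ_[p]), Padic.norm_rat_le_one hden⟩ := by
    refine (PadicInt.ext_of_toZModPow).mp fun k => ?_
    rw [map_zero]
    rcases Nat.eq_zero_or_pos k with rfl | hk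
    · haveI : Subsingleton (ZMod (p ^ 0)) := ZMod.subsingleton_iff.mpr (pow_zero p)
      exact Subsingleton.elim _ _
    · have hk' := h k hk
      rw [kuriharaNumber_one, ratModP_eq_toZModPow p k hden] at hk'
      exact hk'.symm
  have hq : ratPlusSymbol f 0 = 0 := by
    have h1 : ((ratPlusSymbol f 0 : ℚ) : ℚ_[p]) = 0 := by
      rw [show ((ratPlusSymbol f 0 : ℚ) : ℚ_[p]) =
          ((⟨((ratPlusSymbol f 0 : ℚ) : ℚ_[p]), Padic.norm_rat_le_one hden⟩ : ℤ_[p]) : ℚ_[p])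
          from rfl, ← hx0, PadicInt.coe_zero]
    exact_mod_cast h1
  -- hence `L(E,1) = 0` and the order at `1` is positive
  have hL : W.entireLFunction 1 = 0 := by
    rw [hf.entireLFunction_one_eq, hq]
    simp
  have hE : W.HasEntireLFunction :=
    W.hasEntireLFunction_of_cuspCoeff_eq (strictWidthInfty_Gamma0 _) f hf.2
  have hne := analyticRank_ne_zero_of_entireLFunction_one_eq_zero W hE hL
  omega

/-- A non-zero natural number other than `1` has a prime factor. [folklore] -/
theorem one_le_card_primeFactors {n : ℕ} (h0 : n ≠ 0) (h1 : n ≠ 1) : 1 ≤ n.primeFactors.card := by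
  rw [Nat.one_le_iff_ne_zero, Ne, Finset.card_eq_zero, Nat.primeFactors_eq_empty]
  omega

/-! ### Composition: the five stubs imply the crux BY NAME (sorry-free) -/

/-- **The line concludes the crux by name**:
`KL → KU → P → A→ → A← → SelmerRank.SelmerRankRankTwo` (stmt-BirchSwinnertonDyer-0129), using the
landed V0 `Theorems.stub_delta_one`, V1 `Theorems.stub_delta_parity` and the proved rank-0 glue
`one_le_analyticRank_of_kuriharaNumber_one_eq_zero`.
(→) `corank = 2`: KU at `n = 1` kills every `δ_1^{(k)}`, so `r_an ≥ 1`, so `r_an` is even `≥ 2` (P);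
were `r_an ≥ 4`, KL's witness `n` (`ν(n) ≤ 2`, `δ_n ≠ 0`) would vanish by V0 (`n = 1`), V1
(`ν = 1`, wrong parity) or A→ (`ν = 2`). (←) `r_an = 2`: A←'s witness and KU give `corank ≤ 2`, P
makes it even, and `corank = 0` would put KL's witness at `n = 1` with `δ_1 ≠ 0`, against V0.
[folklore] -/
theorem SelmerRankRankTwo_of (hKL : Statement.stub_kim_lower) (hKU : Statement.stub_kim_upper)
    (hP : Statement.stub_parity) (hA : Statement.stub_delta_two_of_four_le)
    (hB : Statement.stub_exists_delta_of_rank_two) : SelmerRank.SelmerRankRankTwo := by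
  intro W _ _ p _ h5 hgood hord hsurj
  have hp2 : p ≠ 2 := by omega
  have hirr : W.HasIrreducibleModPGaloisRep p :=
    hasIrreducibleModPGaloisRep_of_hasSurjectiveModNGaloisRep W p hsurj
  have hpar : W.selmerCorank p % 2 = W.analyticRank % 2 := hP W p h5 hgood hord hsurj
  constructor
  · -- (→) `corank_p = 2 ⇒ r_an = 2`
    intro hc
    obtain ⟨hN, f, hf, k, n, hn0, hk, hkoly, hνle, ψ, hψ, hne⟩ := hKL W p h5 hgood hord hsurj
    haveI := hn0
    -- `r_an ≥ 1`: every `δ_1^{(k')}` vanishes, else KU caps the corank by `ν(1) = 0`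
    have h1 : 1 ≤ W.analyticRank := by
      refine one_le_analyticRank_of_kuriharaNumber_one_eq_zero hf hp2 hirr (fun k' _ => 1)
        fun k' hk' => ?_
      by_contra hne1
      have hcap := hKU W p h5 hgood hord hsurj hN f hf k' 1 hk' Kato.IsKolyvaginProduct.one
        (fun _ => 1) (fun ℓ hℓ => absurd hℓ (by simp [Nat.primeFactors_one])) hne1
      simp [Nat.primeFactors_one] at hcap
      omega
    have heven : Even W.analyticRank := by
      rw [Nat.even_iff]
      omega
    by_contra hne2
    have h4 : 4 ≤ W.analyticRank := by
      obtain ⟨m, hm⟩ := heven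
      omega
    apply hne
    rcases eq_or_ne n 1 with rfl | hn1
    · exact Theorems.stub_delta_one W p hN f hf h1 k ψ
    · have hν1 : 1 ≤ n.primeFactors.card := one_le_card_primeFactors hn0.out hn1
      rcases (show n.primeFactors.card = 1 ∨ n.primeFactors.card = 2 by omega) with hν | hν
      · refine Theorems.stub_delta_parity W p h5 hgood hord hsurj hN f hf k n hk hkoly ?_ ψ hψ
        rw [hν]
        rintro ⟨m, hm⟩
        obtain ⟨m', hm'⟩ := heven
        omega
      · exact hA W p h5 hgood hord hsurj hN f hf k n hk hkoly hν heven h4 ψ hψ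
  · -- (←) `r_an = 2 ⇒ corank_p = 2`
    intro ha
    obtain ⟨hN, f, hf, k, n, hn0, hk, hkoly, hν2, ψ, hψ, hne⟩ := hB W p h5 hgood hord hsurj ha
    haveI := hn0
    have hle : W.selmerCorank p ≤ 2 :=
      (hKU W p h5 hgood hord hsurj hN f hf k n hk hkoly ψ hψ hne).trans hν2
    have hne0 : W.selmerCorank p ≠ 0 := by
      intro h0
      obtain ⟨hN', f', hf', k', n', hn0', hk', hkoly', hνle', ψ', hψ', hne'⟩ :=
        hKL W p h5 hgood hord hsurj
      haveI := hn0'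
      rw [h0, Nat.le_zero, Finset.card_eq_zero, Nat.primeFactors_eq_empty] at hνle'
      rcases hνle' with h | h
      · exact hn0'.out h
      · subst h
        exact hne' (Theorems.stub_delta_one W p hN' f' hf' (by omega) k' ψ')
    omega

/-- Sorry-closed inhabitant of the crux along this line (the sorries are exactly the five stubs;
V0, V1 and the rank-0 glue are theorems). [folklore] -/
theorem SelmerRankRankTwo_proof : SelmerRank.SelmerRankRankTwo :=
  SelmerRankRankTwo_of stub_kim_lower stub_kim_upper stub_parity stub_delta_two_of_four_le
    stub_exists_delta_of_rank_two

end Summit.BirchSwinnertonDyer.BirchSwinnertonDyer.Cruxes.SelmerRankRankTwo.KuriharaTwo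

end
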